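import Literature.NumberTheory.Automorphic.Liu2021.Def411WeilCarriersDoubling     -- ★ `doubledWeilRep χ`, `IsDoubledWeilRep`; via GR: `S3'_propagate`, `rFD`
import Literature.NumberTheory.K2Lit.DoublingEmbedding                           -- ★ D3: `iotaV`, `isSiegelDelta_iotaV_diag`
import Literature.NumberTheory.Automorphic.Liu2021.Def411WeilCarriers            -- ★ `JW a′`, `JW_apply_ne_zero` (the hermitian line `⟨a′⟩`)
import Literature.NumberTheory.Automorphic.UnitaryGroupAdelicCenterRational      -- ★ `adelicCenter_mem_range_toAdelic`
import Literature.NumberTheory.Automorphic.UnitaryGroupAdelicDet                 -- ★ `adelicDet`, `coe_adelicDet_toAdelic`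
import Mathlib.MeasureTheory.Integral.Bochner.Basic
import HarnessLib

/-!
# K2Lit — the THETA FUNCTION of the doubled Weil representation and its weighted integral over the centre (DEFS leaf O42.3c)

Topic `NumberTheory/K2Lit` (Track B, build stream 29; item of record hLiu418 = stmt-HodgeConjecture-24832; steward of socket #42R
`sig_K2LiuEisensteinResidueIsThetaIntegral`: `hodgecm-mathlib-K2Liu-p02` (g2), REPORT-FIRST §3 organ O42.3, 2026-09-04).  Definitions and proved
lemmas only: **no `sorry`, no named fact, no instance, no notation.**

Companion of ★ `K2Lit/SiegelWeilSectionLine` (the Siegel–Weil SECTION `f_Φ(h) = (ω(r_F(δ)·sD h)Φ)(0)` of the trivial partner line, p856173): the other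
side of the anisotropic Siegel–Weil formula [GanQiuTakeda2014, §7 Thm. 18 (m = 1 ≤ n)] is the THETA INTEGRAL of the same Weil representation
★ `IsDoubledWeilRep χ sD` of `H(𝔸) = U(𝕍 ⊕ −𝕍)(𝔸)` (partner line `⟨1⟩`, i.e. the dual pair `(U(𝔻), U(1))` with `U(1) = centre`):

* `swTheta sD Φ h := Θ(ω(sD h)Φ)` (Weil's theta distribution ★ `thetaDistLM` after the operator of `sD h`), and **`swTheta_ratH_mul`**: for a
  `χ`-normalised `sD` it is LEFT `H(L⁺)`-INVARIANT — `sD` carries `H(L⁺)` into Weil's rational lift `r_F(Sp_{2(n+n)}(L⁺))` (★ `S3'_propagate` ∘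
  `S3_parabolic_rational` ∘ `S2_ratH_normalClosure_siegel`, the tree's proof of [GelbartRogawski1991, Prop. 3.1.1]) whose operators fix `Θ`
  (★ `thetaDist_omega_ratThetaLiftCont`, [Weil1964, n° 41 Thm. 6]);
* `centreH u := ι(u·1_V, u·1_V)` — the centre `U(1)(𝔸_{L⁺}) →* H(𝔸)` (★ `iotaV`, ★ `adelicCenter`), in `P_Δ(𝔸)` (`centreH_isSiegelDelta`), central
  (`centreH_mul_comm`, matrix `u • 1`), and RATIONAL on principal norm-one idèles (`centreH_mem_ratH`);
* `swThetaLift sD Φ a′ μ f h := ∫_{[U(⟨a′⟩)]} f(q) · swTheta sD Φ (h · centreH(det q̃)) dμ(q)` — the weighted theta integral over the compact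
  centre quotient, read (as ★ D8 and the s5 seam do) on `[U(J_W a′)] = U(J_W a′)(𝔸) ⧸ U(J_W a′)(L⁺)` through ★ `adelicDet` and `Quotient.out`
  (the tier-0 `twistD` idiom); `swTheta_centreH_rational_mul` shows the integrand does not depend on the representative.

Nothing printed is asserted (the Siegel–Weil identities are sockets).  HONEST LABEL: HC_CM is proved only modulo the 7 printed citations (2 remaining
named inputs: hLiu418 = stmt-HodgeConjecture-24832, h413 = stmt-HodgeConjecture-24833) until rung 0 closes.

References: [GanQiuTakeda2014] §1.9, §7 Thm. 18; [KudlaRallis1994] §1, §6 (theta integral `I(g, φ)`); [Weil1964] Chap. III n° 41 Thm. 6 p. 193;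
[GelbartRogawski1991] §3.1 Prop. 3.1.1 p. 455, Remark p. 457; [Liu2021] App. B (B.7), p. 104; [Ichino2004] §1.
-/

set_option autoImplicit false
-- the doubled metaplectic carrier `Mp(𝕎^𝔻)ᶜᵒⁿᵗ` elaborates slowly (cf. ★ `SiegelWeilSectionLine`): term-mode chains, generous heartbeats
set_option maxHeartbeats 2000000

noncomputable section

open NumberField IsDedekindDomain MeasureTheory
open scoped Matrix

namespace Literature.NumberTheory.K2Lit.SiegelDoubled

open Literature.NumberTheory.Automorphic Literature.NumberTheory.Automorphic.UnitaryGroup Literature.NumberTheory.GaloisRepresentations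
open Literature.NumberTheory.GelbartRogawski1991 Literature.NumberTheory.GelbartRogawski1991.GRConstruction
open Literature.NumberTheory.Automorphic.Liu2021.Def411WeilCarriers
open Literature.NumberTheory.Automorphic.Liu2021.Def411WeilCarriersDoubling
open Literature.NumberTheory.Weil1964
open Literature.RepresentationTheory.HarrisKudlaSweet1996

variable (L : Type) [Field L] [NumberField L] [IsCMField L]
variable {N M n : ℕ} (e : Fin N × Fin M ≃ Fin n)
  (dV : Fin N → L) (hdV : ∀ i, IsCMField.complexConj L (dV i) = dV i) (hdV0 : ∀ i, dV i ≠ 0)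
  (dW : Fin M → L) (hdW : ∀ i, IsCMField.complexConj L (dW i) = dW i) (hdW0 : ∀ i, dW i ≠ 0)

/-! ## 1. The theta function `θ_Φ(h) = Θ(ω(sD h)Φ)` and its left `H(L⁺)`-invariance -/

/-- **`θ_Φ(h) := Θ(ω(sD h)Φ)`** — Weil's theta distribution after the Weil operator of `sD h` (`sD : H(𝔸) →* Mp(𝕎^𝔻)ᶜᵒⁿᵗ`).
[cite: Weil1964, Chap. III n° 41 Thm. 6 p. 193] [cite: KudlaRallis1994, §1] -/
def swTheta (sD : HA L e dV hdV dW hdW →* MpD L e dV hdV dW hdW) (Φ : piSchwartzBruhat (Fp L) (Fin (n + n))) (h : HA L e dV hdV dW hdW) : ℂ :=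
  thetaDistLM (Fp L) (Fin (n + n)) (adelicMpCont.omega (Fp L) (Fin (n + n)) (gramDA L e dV hdV dW hdW) (sD h) Φ)

/-- **a `χ`-normalised doubled Weil representation carries `H(L⁺)` into Weil's rational lift `r_F(Sp(L⁺))`** (the tree's Prop. 3.1.1 chain: S3 on
`P_Δ(L⁺)`, S2 normal closure, S3′ propagation). [cite: GelbartRogawski1991, §3.1 Prop. 3.1.1 p. 455] -/
theorem IsDoubledWeilRep.mem_range_rFD_of_mem_ratH {χ : HeckeCharacter L} {sD : HA L e dV hdV dW hdW →* MpD L e dV hdV dW hdW}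
    (hsD : IsDoubledWeilRep L e dV hdV hdV0 dW hdW hdW0 χ sD) {γ : HA L e dV hdV dW hdW} (hγ : γ ∈ ratH L e dV hdV dW hdW) :
    sD γ ∈ (rFD L e dV hdV hdV0 dW hdW hdW0).range :=
  S3'_propagate L e dV hdV hdV0 dW hdW hdW0 χ hsD (S3_parabolic_rational L e dV hdV hdV0 dW hdW hdW0 χ hsD)
    (S2_ratH_normalClosure_siegel L e dV hdV hdV0 dW hdW hdW0) γ hγ

/-- **LEFT `H(L⁺)`-INVARIANCE of `θ_Φ`**: `θ_Φ(γ·h) = θ_Φ(h)` for `γ ∈ H(L⁺)` — `ω(sD γ) = ω(r_F B)` fixes `Θ`.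
[cite: Weil1964, Chap. III n° 41 Thm. 6 p. 193] [cite: GelbartRogawski1991, §3.1 Prop. 3.1.1 p. 455] -/
theorem swTheta_ratH_mul {χ : HeckeCharacter L} {sD : HA L e dV hdV dW hdW →* MpD L e dV hdV dW hdW}
    (hsD : IsDoubledWeilRep L e dV hdV hdV0 dW hdW hdW0 χ sD) (Φ : piSchwartzBruhat (Fp L) (Fin (n + n)))
    {γ : HA L e dV hdV dW hdW} (hγ : γ ∈ ratH L e dV hdV dW hdW) (h : HA L e dV hdV dW hdW) :
    swTheta L e dV hdV dW hdW sD Φ (γ * h) = swTheta L e dV hdV dW hdW sD Φ h := by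
  obtain ⟨B, hB⟩ := IsDoubledWeilRep.mem_range_rFD_of_mem_ratH L e dV hdV hdV0 dW hdW hdW0 hsD hγ
  -- `ω(sD(γ h))Φ = ω(r_F B)(ω(sD h)Φ)` (term-mode transport; no `rw` under `Mp(𝕎^𝔻)ᶜᵒⁿᵗ`)
  have hmul := MonoidHom.map_mul sD γ h
  have hop := LinearMap.congr_fun
    ((adelicMpCont.omega (Fp L) (Fin (n + n)) (gramDA L e dV hdV dW hdW)).map_mul (sD γ) (sD h)) Φ
  have h1 : adelicMpCont.omega (Fp L) (Fin (n + n)) (gramDA L e dV hdV dW hdW) (sD (γ * h)) Φ =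
      adelicMpCont.omega (Fp L) (Fin (n + n)) (gramDA L e dV hdV dW hdW) (rFD L e dV hdV hdV0 dW hdW hdW0 B)
        (adelicMpCont.omega (Fp L) (Fin (n + n)) (gramDA L e dV hdV dW hdW) (sD h) Φ) :=
    (congrArg (fun q => adelicMpCont.omega (Fp L) (Fin (n + n)) (gramDA L e dV hdV dW hdW) q Φ) hmul).trans
      (hop.trans (congrArg (fun q => adelicMpCont.omega (Fp L) (Fin (n + n)) (gramDA L e dV hdV dW hdW) q
        (adelicMpCont.omega (Fp L) (Fin (n + n)) (gramDA L e dV hdV dW hdW) (sD h) Φ)) hB.symm))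
  unfold swTheta
  exact (congrArg (thetaDistLM (Fp L) (Fin (n + n))) h1).trans
    (thetaDist_omega_ratThetaLiftCont (Fp L) (gramDA L e dV hdV dW hdW) (isUnit_det_gramDA L e dV hdV hdV0 dW hdW hdW0) B _)

/-! ## 2. The centre `U(1)(𝔸_{L⁺}) →* H(𝔸)` -/

/-- **`centreH u := ι(u·1_V, u·1_V)`** — the scalar `u·1_{2n} ∈ H(𝔸)` as the doubling-diagonal image of the centre of `U(V)` (★ `iotaV`, ★ `adelicCenter`).
[cite: GelbartRogawski1991, §3.1 Remark p. 457] -/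
def centreH : adelicOne (Fp L) L (IsCMField.complexConj L) →* HA L e dV hdV dW hdW :=
  (iotaV L e dV hdV dW hdW).comp
    ((adelicCenter (Fp L) L (IsCMField.complexConj L) N (Matrix.diagonal dV)).prod
      (adelicCenter (Fp L) L (IsCMField.complexConj L) N (Matrix.diagonal dV)))

/-- unfolding. [cite: GelbartRogawski1991, §3.1 Remark p. 457] -/
theorem centreH_apply (u : adelicOne (Fp L) L (IsCMField.complexConj L)) :
    centreH L e dV hdV dW hdW u = iotaV L e dV hdV dW hdW
      (adelicCenter (Fp L) L (IsCMField.complexConj L) N (Matrix.diagonal dV) u,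
        adelicCenter (Fp L) L (IsCMField.complexConj L) N (Matrix.diagonal dV) u) := rfl

/-- `centreH u ∈ P_Δ(𝔸)` (the diagonal lies in the Siegel parabolic, ★ `isSiegelDelta_iotaV_diag`). [cite: Kudla1994, §2] -/
theorem centreH_isSiegelDelta (u : adelicOne (Fp L) L (IsCMField.complexConj L)) :
    IsSiegelDelta L e dV hdV dW hdW (centreH L e dV hdV dW hdW u) :=
  isSiegelDelta_iotaV_diag L e dV hdV dW hdW _

/-- the matrix of `centreH u` is the scalar `u • 1_{2n}`. [cite: GelbartRogawski1991, §3.1 Remark p. 457] -/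
theorem coe_centreH (u : adelicOne (Fp L) L (IsCMField.complexConj L)) :
    (((centreH L e dV hdV dW hdW u : HA L e dV hdV dW hdW) : GL (Fin (n + n)) (AdeleRing (𝓞 L) L)) :
        Matrix (Fin (n + n)) (Fin (n + n)) (AdeleRing (𝓞 L) L)) =
      ((u : (AdeleRing (𝓞 L) L)ˣ) : AdeleRing (𝓞 L) L) • (1 : Matrix (Fin (n + n)) (Fin (n + n)) (AdeleRing (𝓞 L) L)) := by
  rw [centreH_apply, iotaV_diag, coe_diagG, UnitaryGroup.coe_reindexGL, UnitaryGroup.coe_blockDiagGL, UnitaryGroup.coe_reindexGL,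
    coe_adelicInl, coe_adelicCenter, Matrix.smul_kronecker, Matrix.one_kronecker_one, Matrix.smul_one_eq_diagonal, Matrix.smul_one_eq_diagonal,
    Matrix.reindex_apply, Matrix.reindex_apply, Matrix.submatrix_diagonal_equiv, Matrix.fromBlocks_diagonal, Matrix.submatrix_diagonal_equiv]
  congr 1
  funext k
  simp only [Function.comp_apply]
  generalize (e₂ (n := n)).symm k = x
  cases x <;> rfl

/-- `centreH u` is central in `H(𝔸)`. [cite: GelbartRogawski1991, §3.1 Remark p. 457] -/
theorem centreH_mul_comm (u : adelicOne (Fp L) L (IsCMField.complexConj L)) (h : HA L e dV hdV dW hdW) :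
    centreH L e dV hdV dW hdW u * h = h * centreH L e dV hdV dW hdW u := by
  apply Subtype.ext
  apply Units.ext
  rw [Subgroup.coe_mul, Subgroup.coe_mul, Units.val_mul, Units.val_mul, coe_centreH, Matrix.smul_mul, Matrix.mul_smul,
    Matrix.one_mul, Matrix.mul_one]

/-- **principal norm-one idèles go to `H(L⁺)`**: if `u ∈ U(1)(𝔸_{L⁺})` is principal then `centreH u ∈ H(L⁺)` (★ `adelicCenter_mem_range_toAdelic`,
★ `adelicInl_toAdelic_mem_range`, ★ `diagG_rational`). [cite: Mok2014, §1 Notation p. 5] [cite: GelbartRogawski1991, §3.1 Prop. 3.1.1 p. 455] -/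
theorem centreH_mem_ratH {u : adelicOne (Fp L) L (IsCMField.complexConj L)}
    (hu : ((u : (AdeleRing (𝓞 L) L)ˣ)) ∈ principalIdeles L) : centreH L e dV hdV dW hdW u ∈ ratH L e dV hdV dW hdW := by
  obtain ⟨γ, hγ⟩ := adelicCenter_mem_range_toAdelic (Fp L) L (IsCMField.complexConj L) N (Matrix.diagonal dV) u hu
  rw [centreH_apply, ← hγ, iotaV_diag]
  exact diagG_rational L e dV hdV dW hdW _
    (adelicInl_toAdelic_mem_range (Fp L) L (IsCMField.complexConj L) N M (Matrix.diagonal dV) (Matrix.diagonal dW) γ)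

/-! ## 3. The centre read on the hermitian line `U(⟨a′⟩)` -/

section Line

variable (a' : (↥(maximalRealSubfield L))ˣ)

/-- **the centre read on `U(J_W a′)(𝔸)`**: `y ↦ centreH (det y)` (every element of the rank-one group is `(det y)·1₁`).
[cite: Mok2014, §1 Notation p. 5] -/
def centreLine : ↥(UnitaryGroup.adelic (Fp L) L (IsCMField.complexConj L) 1 (JW (Fp L) L a')) →* HA L e dV hdV dW hdW :=
  (centreH L e dV hdV dW hdW).comp (adelicDet (Fp L) L (IsCMField.complexConj L) 1 (JW (Fp L) L a')
    (by rw [Matrix.det_fin_one]; exact JW_apply_ne_zero (Fp L) L a'))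

/-- rational points of the line go to `H(L⁺)`. [cite: Mok2014, §1 Notation p. 5] -/
theorem centreLine_mem_ratH {y : ↥(UnitaryGroup.adelic (Fp L) L (IsCMField.complexConj L) 1 (JW (Fp L) L a'))}
    (hy : y ∈ (UnitaryGroup.toAdelic (Fp L) L (IsCMField.complexConj L) 1 (JW (Fp L) L a')).range) :
    centreLine L e dV hdV dW hdW a' y ∈ ratH L e dV hdV dW hdW := by
  obtain ⟨γ, rfl⟩ := hy
  refine centreH_mem_ratH L e dV hdV dW hdW ?_
  rw [coe_adelicDet_toAdelic]
  exact ⟨_, rfl⟩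

/-- **the integrand is a class function**: `θ_Φ(h · centreLine(y γ)) = θ_Φ(h · centreLine y)` for rational `γ` (`centreLine γ ∈ H(L⁺)` is central, and
`θ_Φ` is left `H(L⁺)`-invariant). [cite: Weil1964, Chap. III n° 41 Thm. 6 p. 193] [cite: Liu2021, App. B (B.7) p. 104] -/
theorem swTheta_mul_centreLine_mul_rational {χ : HeckeCharacter L} {sD : HA L e dV hdV dW hdW →* MpD L e dV hdV dW hdW}
    (hsD : IsDoubledWeilRep L e dV hdV hdV0 dW hdW hdW0 χ sD) (Φ : piSchwartzBruhat (Fp L) (Fin (n + n))) (h : HA L e dV hdV dW hdW)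
    (y : ↥(UnitaryGroup.adelic (Fp L) L (IsCMField.complexConj L) 1 (JW (Fp L) L a')))
    {γ : ↥(UnitaryGroup.adelic (Fp L) L (IsCMField.complexConj L) 1 (JW (Fp L) L a'))}
    (hγ : γ ∈ (UnitaryGroup.toAdelic (Fp L) L (IsCMField.complexConj L) 1 (JW (Fp L) L a')).range) :
    swTheta L e dV hdV dW hdW sD Φ (h * centreLine L e dV hdV dW hdW a' (y * γ)) =
      swTheta L e dV hdV dW hdW sD Φ (h * centreLine L e dV hdV dW hdW a' y) := by
  have hc : h * centreLine L e dV hdV dW hdW a' (y * γ) =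
      centreLine L e dV hdV dW hdW a' γ * (h * centreLine L e dV hdV dW hdW a' y) := by
    rw [map_mul, ← mul_assoc]
    exact (centreH_mul_comm L e dV hdV dW hdW _ _).symm
  rw [hc]
  exact swTheta_ratH_mul L e dV hdV hdV0 dW hdW hdW0 hsD Φ (centreLine_mem_ratH L e dV hdV dW hdW a' hγ) _

/-- **the integrand on representatives**: at `q = yΓ`, `θ_Φ(h · centreLine(q̃)) = θ_Φ(h · centreLine(y))` (the chosen representative differs from `y`
by a rational element). [cite: Weil1964, Chap. III n° 41 Thm. 6 p. 193] -/
theorem swTheta_mul_centreLine_out_mk {χ : HeckeCharacter L} {sD : HA L e dV hdV dW hdW →* MpD L e dV hdV dW hdW}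
    (hsD : IsDoubledWeilRep L e dV hdV hdV0 dW hdW hdW0 χ sD) (Φ : piSchwartzBruhat (Fp L) (Fin (n + n))) (h : HA L e dV hdV dW hdW)
    (y : ↥(UnitaryGroup.adelic (Fp L) L (IsCMField.complexConj L) 1 (JW (Fp L) L a'))) :
    swTheta L e dV hdV dW hdW sD Φ (h * centreLine L e dV hdV dW hdW a'
        (Quotient.out (QuotientGroup.mk y : ↥(UnitaryGroup.adelic (Fp L) L (IsCMField.complexConj L) 1 (JW (Fp L) L a')) ⧸
          (UnitaryGroup.toAdelic (Fp L) L (IsCMField.complexConj L) 1 (JW (Fp L) L a')).range))) =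
      swTheta L e dV hdV dW hdW sD Φ (h * centreLine L e dV hdV dW hdW a' y) := by
  obtain ⟨γ, hγ⟩ := QuotientGroup.mk_out_eq_mul (UnitaryGroup.toAdelic (Fp L) L (IsCMField.complexConj L) 1 (JW (Fp L) L a')).range y
  rw [hγ]
  exact swTheta_mul_centreLine_mul_rational L e dV hdV hdV0 dW hdW hdW0 a' hsD Φ h y γ.2

end Line

/-! ## 4. The weighted theta integral over the centre quotient `[U(⟨a′⟩)]` -/

section Lift

variable (sD : HA L e dV hdV dW hdW →* MpD L e dV hdV dW hdW) (Φ : piSchwartzBruhat (Fp L) (Fin (n + n))) (a' : (↥(maximalRealSubfield L))ˣ)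
  [MeasurableSpace (↥(UnitaryGroup.adelic (Fp L) L (IsCMField.complexConj L) 1 (JW (Fp L) L a')) ⧸
    (UnitaryGroup.toAdelic (Fp L) L (IsCMField.complexConj L) 1 (JW (Fp L) L a')).range)]
  (μ : Measure (↥(UnitaryGroup.adelic (Fp L) L (IsCMField.complexConj L) 1 (JW (Fp L) L a')) ⧸
    (UnitaryGroup.toAdelic (Fp L) L (IsCMField.complexConj L) 1 (JW (Fp L) L a')).range))
  (f : C(↥(UnitaryGroup.adelic (Fp L) L (IsCMField.complexConj L) 1 (JW (Fp L) L a')) ⧸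
    (UnitaryGroup.toAdelic (Fp L) L (IsCMField.complexConj L) 1 (JW (Fp L) L a')).range, ℂ))

/-- **The weighted theta integral over the centre quotient `[U(⟨a′⟩)]`**:
`Θ̃_Φ(f)(h) := ∫_{[U(⟨a′⟩)]} f(q) · θ_Φ(h · centreLine(q̃)) dμ(q)`, `q̃ = Quotient.out q` (the tier-0 `twistD` idiom; representative-independence is
`swTheta_mul_centreLine_mul_rational`).  With `f = 1` and `μ` the invariant probability this is the theta integral `I(h; Φ)` of the dual pair
`(U(𝔻), U(1))` in the normalisation of ★ `IsDoubledWeilRep χ sD` [KudlaRallis1994 §6; GanQiuTakeda2014 §1.9]; a general continuous weight `f` absorbs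
the centre character (steward's finding «CENTRE WEIGHT»). [cite: KudlaRallis1994, §6] [cite: GanQiuTakeda2014, §1.9] [cite: Liu2021, App. B (B.7) p. 104] -/
def swThetaLift (h : HA L e dV hdV dW hdW) : ℂ :=
  ∫ q, f q * swTheta L e dV hdV dW hdW sD Φ (h * centreLine L e dV hdV dW hdW a' (Quotient.out q)) ∂μ

/-- unfolding of `swThetaLift`. [cite: KudlaRallis1994, §6] -/
theorem swThetaLift_apply (h : HA L e dV hdV dW hdW) :
    swThetaLift L e dV hdV dW hdW sD Φ a' μ f h =
      ∫ q, f q * swTheta L e dV hdV dW hdW sD Φ (h * centreLine L e dV hdV dW hdW a' (Quotient.out q)) ∂μ := rfl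


/-- **automorphy of the weighted theta integral**: `Θ̃_Φ(f)(γ h) = Θ̃_Φ(f)(h)` for `γ ∈ H(L⁺)` (pointwise under the integral, from `swTheta_ratH_mul`).
[cite: Weil1964, Chap. III n° 41 Thm. 6 p. 193] [cite: KudlaRallis1994, §6] -/
theorem swThetaLift_ratH_mul {χ : HeckeCharacter L} (hsD : IsDoubledWeilRep L e dV hdV hdV0 dW hdW hdW0 χ sD)
    {γ : HA L e dV hdV dW hdW} (hγ : γ ∈ ratH L e dV hdV dW hdW) (h : HA L e dV hdV dW hdW) :
    swThetaLift L e dV hdV dW hdW sD Φ a' μ f (γ * h) = swThetaLift L e dV hdV dW hdW sD Φ a' μ f h := by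
  unfold swThetaLift
  refine congrArg (fun F : _ → ℂ => ∫ q, F q ∂μ) (funext fun q => congrArg (fun z => f q * z) ?_)
  exact (congrArg (swTheta L e dV hdV dW hdW sD Φ) (mul_assoc γ h _)).trans
    (swTheta_ratH_mul L e dV hdV hdV0 dW hdW hdW0 hsD Φ hγ _)

/-- **linearity in the weight**. [cite: KudlaRallis1994, §6] -/
theorem swThetaLift_weight_smul (c : ℂ) (h : HA L e dV hdV dW hdW) :
    swThetaLift L e dV hdV dW hdW sD Φ a' μ (c • f) h = c * swThetaLift L e dV hdV dW hdW sD Φ a' μ f h := by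
  unfold swThetaLift
  rw [← integral_const_mul]
  refine congrArg (fun F : _ → ℂ => ∫ q, F q ∂μ) (funext fun q => ?_)
  rw [ContinuousMap.smul_apply, smul_eq_mul, mul_assoc]

end Lift

end Literature.NumberTheory.K2Lit.SiegelDoubled

end
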